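import Literature.Computability.Complexity.MonotoneSwitching
import HarnessLib

/-!
# The Monotone Switching Lemma, uniformly along a chain of families (Jukna 2012, §9.6, proof of Thm 9.21)

In the criterion for monotone REAL circuits (Jukna 2012, Theorem 9.21; the proof presented there is
due to A. Wigderson) every real-valued gate `f` is approximated through ALL its threshold functions
`f⁽ᵃ⁾ = [f ≥ a]` at once, and the crucial point is that the errors introduced at one gate, over all
(finitely many) thresholds `a`, are corrected by ONE exact family of clauses (resp. monomials) of
the same size as in the Boolean case: the DNFs `D_a` representing the thresholds are NESTED
(`D_{a'} ⊆ D_a` for `a ≤ a'`), hence so are their transversal families.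

This file proves the combinatorial heart of that argument in the form used by
`MonotoneSwitching.lean` (transversal trees, Jukna 2012 Lemma 9.15):

* `exists_transversal_tree_chain` — ONE transversal tree serving every member of a CHAIN (a family
  of set families totally ordered by inclusion): branching always on a missed member of the
  SMALLEST family the current node fails to hit, the depth-`k` frontier (`≤ w^k` nodes of size
  `#p + k`) catches, for every level `l`, every transversal `S ⊇ p` of the level-`l` family that
  contains no transversal of that family of size `< #p + k` through `p`.
* `chainSwitching_dnf` — DNF → CNF uniformly along a chain of DNFs of width `≤ w`: level-wise
  `(s-1)`-CNFs `cnf l ≥ E l` (all small transversals; antitone in the family) and ONE exact family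
  `C` of `s`-clauses, `#C ≤ w^s`, with `cnf l ∧ C ≤ E l` for every level `l`.
* `chainSwitching_cnf` — the dual, CNF → DNF uniformly along a chain of CNFs of width `≤ w`:
  level-wise `(r-1)`-DNFs `dnf l ≤ G l` and ONE exact family `D` of `r`-monomials, `#D ≤ w^r`,
  with `G l ≤ dnf l ∨ D` for every level `l`.

## References

* S. Jukna, *Boolean Function Complexity: Advances and Frontiers*, Springer (2012), §9.6,
  Theorem 9.21 (Criterion for Real Circuits) and its proof, pp. 277–280; Lemma 9.15 [Jukna2012].
* S. Jukna, Combinatorics of monotone computations, Combinatorica 19(1) (1999) 65–85 (the original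
  finite-limit proof).
-/

namespace Literature.Computability.Complexity

open Finset

variable {ι : Type*} [DecidableEq ι]

/-! ### One transversal tree for a chain of families -/

/-- **Transversal tree of a chain of families** (Jukna 2012, proof of Thm 9.21 via Lemma 9.15,
uniform version): let `E l` (`l ∈ L`) be set families totally ordered by inclusion, all members of
size `≤ w`. Growing from the node `p` to depth `k`, branching at a node over the elements of a
missed member of the SMALLEST family the node fails to hit, gives a frontier `Fr` of `≤ w^k` sets
of size `#p + k` above `p` such that, for EVERY level `l`, every set `S ⊇ p` hitting all members
of `E l` either contains a set `T`, `p ⊆ T`, `#T < #p + k`, hitting all members of `E l`, or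
contains a frontier set. [cite: Jukna2012, Thm. 9.21 and Lemma 9.15] -/
theorem exists_transversal_tree_chain {L : Type*} (E : L → Finset (Finset ι))
    (hchain : ∀ l l', E l ⊆ E l' ∨ E l' ⊆ E l) (w : ℕ) (hw : ∀ l, ∀ q ∈ E l, #q ≤ w) (k : ℕ) :
    ∀ p : Finset ι, ∃ Fr : Finset (Finset ι), (∀ P ∈ Fr, #P = #p + k ∧ p ⊆ P) ∧ #Fr ≤ w ^ k ∧
      ∀ (l : L) (S : Finset ι), p ⊆ S → (∀ q ∈ E l, (S ∩ q).Nonempty) →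
        (∃ T : Finset ι, p ⊆ T ∧ T ⊆ S ∧ #T < #p + k ∧ ∀ q ∈ E l, (T ∩ q).Nonempty) ∨
        (∃ P ∈ Fr, P ⊆ S) := by
  classical
  induction k with
  | zero =>
    intro p
    exact ⟨{p}, by simp, by simp, fun l S hpS _ => Or.inr ⟨p, by simp, hpS⟩⟩
  | succ k ih =>
    intro p
    by_cases hall : ∀ l, ∀ q ∈ E l, (p ∩ q).Nonempty
    · refine ⟨∅, by simp, by simp, fun l S hpS _ => Or.inl ⟨p, Subset.rfl, hpS, by omega, hall l⟩⟩
    · push Not at hall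
      -- a failing level whose family has the least cardinality
      have hex : ∃ n, ∃ l, (∃ q ∈ E l, ¬ (p ∩ q).Nonempty) ∧ #(E l) = n := by
        obtain ⟨l, q, hq, hpq⟩ := hall
        exact ⟨_, l, ⟨q, hq, not_nonempty_iff_eq_empty.2 hpq⟩, rfl⟩
      obtain ⟨l₀, ⟨q₀, hq₀, hpq₀⟩, hcard₀⟩ := Nat.find_spec hex
      have hmin : ∀ l, (∃ q ∈ E l, ¬ (p ∩ q).Nonempty) → #(E l₀) ≤ #(E l) := fun l hl => by
        rw [hcard₀]
        exact Nat.find_min' hex ⟨l, hl, rfl⟩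
      have hvp : ∀ v ∈ q₀, v ∉ p := fun v hv hvp' => hpq₀ ⟨v, mem_inter.2 ⟨hvp', hv⟩⟩
      choose Fr hFr hcard hcov using fun v : ι => ih (insert v p)
      refine ⟨q₀.biUnion Fr, ?_, ?_, ?_⟩
      · intro P hP
        obtain ⟨v, hv, hP⟩ := mem_biUnion.1 hP
        obtain ⟨h1, h2⟩ := hFr v P hP
        rw [card_insert_of_notMem (hvp v hv)] at h1
        exact ⟨by omega, (subset_insert v p).trans h2⟩
      · calc #(q₀.biUnion Fr) ≤ #q₀ * w ^ k := card_biUnion_le_card_mul q₀ Fr (w ^ k) fun v _ => hcard v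
          _ ≤ w * w ^ k := Nat.mul_le_mul_right _ (hw l₀ q₀ hq₀)
          _ = w ^ (k + 1) := by rw [pow_succ']
      · intro l S hpS hS
        by_cases hp : ∀ q ∈ E l, (p ∩ q).Nonempty
        · exact Or.inl ⟨p, Subset.rfl, hpS, by omega, hp⟩
        · push Not at hp
          -- the least failing family lies below `E l`, so `q₀ ∈ E l`
          have hsub : E l₀ ⊆ E l := by
            rcases hchain l₀ l with h | h
            · exact h
            · obtain ⟨q, hq, hpq⟩ := hp
              exact (eq_of_subset_of_card_le h
                (hmin l ⟨q, hq, not_nonempty_iff_eq_empty.2 hpq⟩)).symm ▸ Subset.rfl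
          obtain ⟨v, hv⟩ := hS q₀ (hsub hq₀)
          rw [mem_inter] at hv
          have hins : insert v p ⊆ S := insert_subset hv.1 hpS
          rcases hcov v l S hins hS with ⟨T, hpT, hTS, hTcard, hT⟩ | ⟨P, hP, hPS⟩
          · refine Or.inl ⟨T, (subset_insert v p).trans hpT, hTS, ?_, hT⟩
            rw [card_insert_of_notMem (hvp v hv.2)] at hTcard
            omega
          · exact Or.inr ⟨P, mem_biUnion.2 ⟨v, hv.2, hP⟩, hPS⟩

/-! ### The switching lemma, uniformly along a chain -/

/-- **Monotone Switching Lemma along a chain, DNF to CNF** (Jukna 2012, proof of Thm 9.21, left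
approximators): for DNFs `E l` (`l ∈ L`) totally ordered by inclusion with monomials of size `≤ w`,
the `(s-1)`-CNFs `cnf l` of ALL transversals of `E l` of size `< s` satisfy `E l ≤ cnf l`, are
antitone in the family (`E l ⊆ E l' → cnf l' ⊆ cnf l`), and ONE exact family `C` of `s`-clauses
with `#C ≤ w^s` corrects all of them: `cnf l ∧ C ≤ E l` for every `l`.
[cite: Jukna2012, Thm. 9.21 and Lemma 9.15] -/
theorem chainSwitching_dnf [Fintype ι] {L : Type*} (E : L → Finset (Finset ι))
    (hchain : ∀ l l', E l ⊆ E l' ∨ E l' ⊆ E l) (w s : ℕ) (hw : ∀ l, ∀ R ∈ E l, #R ≤ w) :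
    ∃ (cnf : L → Finset (Finset ι)) (C : Finset (Finset ι)),
      (∀ l, ∀ S ∈ cnf l, #S ≤ s - 1) ∧ (∀ P ∈ C, #P = s) ∧ #C ≤ w ^ s ∧
      (∀ l l', E l ⊆ E l' → cnf l' ⊆ cnf l) ∧
      (∀ l x, EvalDNF (E l) x → EvalCNF (cnf l) x) ∧
      (∀ l x, EvalCNF (cnf l) x → EvalCNF C x → EvalDNF (E l) x) := by
  classical
  obtain ⟨Fr, hFr, hcard, hcov⟩ := exists_transversal_tree_chain E hchain w hw s ∅
  refine ⟨fun l => (univ : Finset ι).powerset.filter fun T => #T < s ∧ ∀ q ∈ E l, (T ∩ q).Nonempty,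
    Fr, fun l S hS => ?_, fun P hP => by simpa using (hFr P hP).1, hcard, fun l l' hll' => ?_,
    fun l x hx => ?_, fun l x hcnf hC => ?_⟩
  · have := (mem_filter.1 hS).2.1
    omega
  · intro T hT
    rw [mem_filter] at hT ⊢
    exact ⟨hT.1, hT.2.1, fun q hq => hT.2.2 q (hll' hq)⟩
  · -- `E l ≤ cnf l`: a satisfied monomial meets every transversal in a true coordinate
    obtain ⟨R, hR, hRx⟩ := hx
    intro T hT
    obtain ⟨i, hi⟩ := (mem_filter.1 hT).2.2 R hR
    rw [mem_inter] at hi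
    exact ⟨i, hi.1, hRx i hi.2⟩
  · -- correction: if `E l` fails at `x`, its false coordinates form a transversal of `E l`
    -- containing no small transversal (all of those are satisfied clauses), so a frontier clause
    by_contra hno
    set Z : Finset ι := univ.filter fun i => x i = false with hZ
    have hZtr : ∀ q ∈ E l, (Z ∩ q).Nonempty := by
      intro q hq
      by_contra hne
      refine hno ⟨q, hq, fun i hi => ?_⟩
      cases hxi : x i
      · exact absurd ⟨i, mem_inter.2 ⟨mem_filter.2 ⟨mem_univ _, hxi⟩, hi⟩⟩ hne
      · rfl
    rcases hcov l Z (empty_subset _) hZtr with ⟨T, -, hTZ, hTcard, hT⟩ | ⟨P, hP, hPZ⟩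
    · have hTmem : T ∈ (univ : Finset ι).powerset.filter
          fun T => #T < s ∧ ∀ q ∈ E l, (T ∩ q).Nonempty :=
        mem_filter.2 ⟨mem_powerset.2 (subset_univ _), by simpa using hTcard, hT⟩
      obtain ⟨i, hi, hxi⟩ := hcnf T hTmem
      have := (mem_filter.1 (hTZ hi)).2
      rw [hxi] at this
      exact Bool.noConfusion this
    · obtain ⟨i, hi, hxi⟩ := hC P hP
      have := (mem_filter.1 (hPZ hi)).2
      rw [hxi] at this
      exact Bool.noConfusion this

/-- **Monotone Switching Lemma along a chain, CNF to DNF** (Jukna 2012, proof of Thm 9.21, right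
approximators; the dual form): for CNFs `G l` (`l ∈ L`) totally ordered by inclusion with clauses
of size `≤ w`, the `(r-1)`-DNFs `dnf l` of ALL sets of size `< r` meeting every clause of `G l`
satisfy `dnf l ≤ G l`, and ONE exact family `D` of `r`-monomials with `#D ≤ w^r` corrects all of
them: `G l ≤ dnf l ∨ D` for every `l`. [cite: Jukna2012, Thm. 9.21 and Lemma 9.15] -/
theorem chainSwitching_cnf [Fintype ι] {L : Type*} (G : L → Finset (Finset ι))
    (hchain : ∀ l l', G l ⊆ G l' ∨ G l' ⊆ G l) (w r : ℕ) (hw : ∀ l, ∀ S ∈ G l, #S ≤ w) :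
    ∃ (dnf : L → Finset (Finset ι)) (D : Finset (Finset ι)),
      (∀ l, ∀ R ∈ dnf l, #R ≤ r - 1) ∧ (∀ P ∈ D, #P = r) ∧ #D ≤ w ^ r ∧
      (∀ l x, EvalDNF (dnf l) x → EvalCNF (G l) x) ∧
      (∀ l x, EvalCNF (G l) x → EvalDNF (dnf l) x ∨ EvalDNF D x) := by
  classical
  obtain ⟨Fr, hFr, hcard, hcov⟩ := exists_transversal_tree_chain G hchain w hw r ∅
  refine ⟨fun l => (univ : Finset ι).powerset.filter fun T => #T < r ∧ ∀ q ∈ G l, (T ∩ q).Nonempty,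
    Fr, fun l R hR => ?_, fun P hP => by simpa using (hFr P hP).1, hcard,
    fun l x hx => ?_, fun l x hG => ?_⟩
  · have := (mem_filter.1 hR).2.1
    omega
  · -- `dnf l ≤ G l`: a satisfied small transversal of the clauses satisfies every clause
    obtain ⟨T, hT, hTx⟩ := hx
    intro q hq
    obtain ⟨i, hi⟩ := (mem_filter.1 hT).2.2 q hq
    rw [mem_inter] at hi
    exact ⟨i, hi.2, hTx i hi.1⟩
  · -- covering: the true coordinates form a transversal of the clauses; walk the tree inside
    set O : Finset ι := univ.filter fun i => x i = true with hO
    have hOtr : ∀ q ∈ G l, (O ∩ q).Nonempty := by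
      intro q hq
      obtain ⟨i, hi, hxi⟩ := hG q hq
      exact ⟨i, mem_inter.2 ⟨mem_filter.2 ⟨mem_univ _, hxi⟩, hi⟩⟩
    rcases hcov l O (empty_subset _) hOtr with ⟨T, -, hTO, hTcard, hT⟩ | ⟨P, hP, hPO⟩
    · refine Or.inl ⟨T, mem_filter.2 ⟨mem_powerset.2 (subset_univ _), by simpa using hTcard, hT⟩,
        fun i hi => (mem_filter.1 (hTO hi)).2⟩
    · exact Or.inr ⟨P, hP, fun i hi => (mem_filter.1 (hPO hi)).2⟩

end Literature.Computability.Complexity
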